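import Mathlib.LinearAlgebra.Matrix.Rank
import Mathlib.LinearAlgebra.Matrix.NonsingularInverse
import Mathlib.LinearAlgebra.Matrix.Block
import Mathlib.Data.ZMod.Basic
import Mathlib.Algebra.Field.ZMod
import HarnessLib

/-!
# Row-sparse LU rank certificates with candidate columns (kernel-checkable)

Topic `Literature/Computability/AlgebraicComplexity` (support for the computational rank facts behind
Conner–Gesmundo–Landsberg–Ventura 2022, Thm. 1.2; used by `CwCubeKoszulCert.lean` for a
`2058 × 2058` minor).  `SparseLURankCertificate.lean` checks a sparse `L · U ≡ A[r, c] (mod pr)` by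
visiting all `k²` entries of the minor, which is out of reach of the kernel for `k ≈ 2000`.  The
checker of this file visits, in each row, only a user-supplied list of CANDIDATE columns outside of
which the row of `A` is known (by a lemma, not by computation) to vanish, and computes the row of
`L · U` sparsely (concatenate the scaled sparse rows of `U`, then sort-and-combine modulo `pr`).
Its cost is `∑ᵢ (flops of row i) · log + ∑ᵢ |candidates of row i|`, independent of `k²`.  All tables
are packed into numerals (fixed-width fields read by `Nat` shifts, which the kernel evaluates with
GMP), and every loop is a structural recursion (no well-founded recursion), so that `decide` can run
it.  PROVED here once ([folklore]: LU decomposition, multiplicativity of `det`, a non-zero minor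
bounds the rank):

* `RowLU.getW`, `RowLU.decodeRange`, `RowLU.Cert` (+ `row`, `col`, `cinvAt`, `uRow`, `lRow`) — packed
  data: the `k` row codes and column codes of the minor, the inverse column table, and the sparse
  factors `U` (rows from the diagonal on) and `L` (rows strictly below the diagonal; unit diagonal
  implicit) as offset/key/value numerals.
* `RowLU.msum l j` — the value at key `j` of an association list read as a multiset of `(key, value)`
  (sum of all values at that key): the semantics in which every list operation below is exact.
* `RowLU.scaleRow`, `RowLU.accRow`, `RowLU.splitAlt`, `RowLU.mergeKV`, `RowLU.msort` — row `i` of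
  `L · U` as a combined sparse row modulo `pr` (`msum_msort`: same `msum` modulo `pr`; no sortedness
  is needed for soundness, the fuelled sort only keeps the lists short).
* `RowLU.rowCheck`, `RowLU.rowsCheck`, `RowLU.globalCheck` — the checker; `RowLU.rowsCheck_spec`.
* `RowLU.le_rank_of_checks` — **soundness**: given an entry function `ent` on codes agreeing with
  `A` modulo `pr` (`hent`), a candidate function complete on admissible columns (`hcand`: an entry of
  `A` in an admissible column `b` of row `a` is non-zero only if `b ∈ cand a`), the global check and
  all row checks, `k ≤ rank A` over any field of characteristic `0`.

[folklore] throughout.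
-/

namespace Literature.Computability.AlgebraicComplexity

namespace RowLU

open Matrix

/-! ## Packed tables -/

/-- Field `i` of width `w` bits of the packed numeral `N`. [folklore] -/
def getW (N w i : ℕ) : ℕ := (N >>> (w * i)) &&& (2 ^ w - 1)

/-- The `n` consecutive `(key, value)` fields starting at position `a`. [folklore] -/
def decodeRange (key val wk wv : ℕ) : ℕ → ℕ → List (ℕ × ℕ)
  | _, 0 => []
  | a, n + 1 => (getW key wk a, getW val wv a) :: decodeRange key val wk wv (a + 1) n

/-- **Certificate data** for `k ≤ rank A`: sizes of the bit fields, the `k` row codes and column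
codes of the minor (in elimination order), the inverse column table (`cinv[b] = j + 1` if the code
`b` is the `j`-th column, else `0`), and the factors `U` (row `s`: entries `(j, U_{sj})`, `j ≥ s`,
diagonal first or anywhere) and `L` (row `i`: entries `(s, L_{is})`, `s < i`) as offsets into
key/value numerals. [folklore] -/
structure Cert where
  /-- size of the minor -/
  k : ℕ
  /-- bit width of row/column codes and of the entries of `cinv` -/
  wr : ℕ
  /-- bit width of offsets -/
  wo : ℕ
  /-- bit width of keys (indices `< k`) -/
  wk : ℕ
  /-- bit width of values (residues mod `pr`) -/
  wv : ℕ
  /-- packed row codes -/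
  rows : ℕ
  /-- packed column codes -/
  cols : ℕ
  /-- packed inverse column table, indexed by column code -/
  cinv : ℕ
  /-- `U`: packed offsets (`k + 1` of them), keys, values -/
  uOff : ℕ
  uKey : ℕ
  uVal : ℕ
  /-- `L`: packed offsets (`k + 1` of them), keys, values -/
  lOff : ℕ
  lKey : ℕ
  lVal : ℕ

/-- The code of the `i`-th row of the minor. [folklore] -/
def Cert.row (C : Cert) (i : ℕ) : ℕ := getW C.rows C.wr i

/-- The code of the `j`-th column of the minor. [folklore] -/
def Cert.col (C : Cert) (j : ℕ) : ℕ := getW C.cols C.wr j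

/-- The inverse column table at code `b`. [folklore] -/
def Cert.cinvAt (C : Cert) (b : ℕ) : ℕ := getW C.cinv C.wr b

/-- Row `s` of `U` as a `(key, value)` list. [folklore] -/
def Cert.uRow (C : Cert) (s : ℕ) : List (ℕ × ℕ) :=
  decodeRange C.uKey C.uVal C.wk C.wv (getW C.uOff C.wo s)
    (getW C.uOff C.wo (s + 1) - getW C.uOff C.wo s)

/-- Row `i` of `L` (strictly below the diagonal) as a `(key, value)` list. [folklore] -/
def Cert.lRow (C : Cert) (i : ℕ) : List (ℕ × ℕ) :=
  decodeRange C.lKey C.lVal C.wk C.wv (getW C.lOff C.wo i)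
    (getW C.lOff C.wo (i + 1) - getW C.lOff C.wo i)

/-! ## Association lists as multisets of `(key, value)` -/

/-- The value of the list `l` at key `j`: the sum of the values of ALL entries with key `j`.
[folklore] -/
def msum : List (ℕ × ℕ) → ℕ → ℕ
  | [], _ => 0
  | e :: l, j => (if e.1 = j then e.2 else 0) + msum l j

/-- The empty list has value `0` everywhere. [folklore] -/
@[simp] theorem msum_nil (j : ℕ) : msum [] j = 0 := rfl

/-- Unfolding `msum` on a cons. [folklore] -/
@[simp] theorem msum_cons (e : ℕ × ℕ) (l : List (ℕ × ℕ)) (j : ℕ) :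
    msum (e :: l) j = (if e.1 = j then e.2 else 0) + msum l j := rfl

/-- `msum` is additive under concatenation. [folklore] -/
theorem msum_append (l₁ l₂ : List (ℕ × ℕ)) (j : ℕ) :
    msum (l₁ ++ l₂) j = msum l₁ j + msum l₂ j := by
  induction l₁ with
  | nil => simp
  | cons e l ih => simp [ih, add_assoc]

/-- `msum` of a `flatMap` is the sum of the `msum`s. [folklore] -/
theorem msum_flatMap {α : Type*} (f : α → List (ℕ × ℕ)) (l : List α) (j : ℕ) :
    msum (l.flatMap f) j = (l.map fun a => msum (f a) j).sum := by
  induction l with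
  | nil => simp
  | cons a l ih => simp [List.flatMap_cons, msum_append, ih]

/-- A key that does not occur has value `0`. [folklore] -/
theorem msum_eq_zero_of_forall_ne {l : List (ℕ × ℕ)} {j : ℕ} (h : ∀ e ∈ l, e.1 ≠ j) :
    msum l j = 0 := by
  induction l with
  | nil => rfl
  | cons e l ih =>
    rw [msum_cons, if_neg (h e (by simp)), zero_add]
    exact ih fun e' he' => h e' (by simp [he'])

/-- If every entry at key `j` has value divisible by `pr`, so is the value at `j`. [folklore] -/
theorem dvd_msum_of_forall {l : List (ℕ × ℕ)} {j pr : ℕ} (h : ∀ e ∈ l, e.1 = j → pr ∣ e.2) :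
    pr ∣ msum l j := by
  induction l with
  | nil => exact dvd_zero _
  | cons e l ih =>
    rw [msum_cons]
    refine dvd_add ?_ (ih fun e' he' => h e' (by simp [he']))
    split_ifs with he
    · exact h e (by simp) he
    · exact dvd_zero _

/-! ## Row `i` of `L · U`, sparsely -/

/-- Scaling the values of a row by `v` (mod `pr`). [folklore] -/
def scaleRow (pr v : ℕ) (l : List (ℕ × ℕ)) : List (ℕ × ℕ) := l.map fun e => (e.1, v * e.2 % pr)

/-- Row `i` of `L · U` before combination: `U_i ++ ⋃_{(s,v) ∈ L_i} v · U_s`. [folklore] -/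
def accRow (pr : ℕ) (C : Cert) (i : ℕ) : List (ℕ × ℕ) :=
  C.uRow i ++ (C.lRow i).flatMap fun e => scaleRow pr e.2 (C.uRow e.1)

/-- Alternating split of a list. [folklore] -/
def splitAlt : List (ℕ × ℕ) → List (ℕ × ℕ) × List (ℕ × ℕ)
  | [] => ([], [])
  | e :: l => (e :: (splitAlt l).2, (splitAlt l).1)

/-- Fuelled merge of two key-sorted rows, combining equal keys modulo `pr` and dropping zeros
(when the fuel is exhausted the rows are concatenated, which is still exact for `msum`). [folklore] -/
def mergeKV (pr : ℕ) : ℕ → List (ℕ × ℕ) → List (ℕ × ℕ) → List (ℕ × ℕ)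
  | 0, l₁, l₂ => l₁ ++ l₂
  | _ + 1, [], l₂ => l₂
  | _ + 1, e₁ :: l₁, [] => e₁ :: l₁
  | f + 1, e₁ :: l₁, e₂ :: l₂ =>
    if e₁.1 < e₂.1 then e₁ :: mergeKV pr f l₁ (e₂ :: l₂)
    else if e₂.1 < e₁.1 then e₂ :: mergeKV pr f (e₁ :: l₁) l₂
    else if (e₁.2 + e₂.2) % pr = 0 then mergeKV pr f l₁ l₂
    else (e₁.1, (e₁.2 + e₂.2) % pr) :: mergeKV pr f l₁ l₂

/-- Fuelled merge sort of a row by key, combining equal keys modulo `pr`. [folklore] -/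
def msort (pr : ℕ) : ℕ → List (ℕ × ℕ) → List (ℕ × ℕ)
  | 0, l => l
  | _ + 1, [] => []
  | _ + 1, [e] => [e]
  | f + 1, e :: e' :: l =>
    mergeKV pr (l.length + 2) (msort pr f (splitAlt (e :: e' :: l)).1)
      (msort pr f (splitAlt (e :: e' :: l)).2)

/-! ## The checker -/

section Checker

variable (pr : ℕ) (ent : ℕ → ℕ → ℕ) (cand : ℕ → List ℕ) (C : Cert) (fuel : ℕ)

/-- **The check of row `i`**: `U_i` lives on keys `≥ i` with non-zero diagonal, `L_i` on keys
`< i`; every non-zero key of the combined row `i` of `L · U` is the index of a candidate column of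
row `i`; and at every candidate column that is a column of the minor, the entry of `A` (computed by
`ent` on codes) agrees modulo `pr` with the combined row. [folklore] -/
def rowCheck (i : ℕ) : Bool :=
  let acc := msort pr fuel (accRow pr C i)
  let a := C.row i
  let cs := cand a
  ((C.uRow i).all fun e => decide (i ≤ e.1)) &&
  !decide (msum (C.uRow i) i % pr = 0) &&
  ((C.lRow i).all fun e => decide (e.1 < i)) &&
  (acc.all fun e => decide (e.2 % pr = 0) || cs.any fun b => decide (C.cinvAt b = e.1 + 1)) &&
  (cs.all fun b =>
    decide (C.cinvAt b = 0) ||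
      (decide (C.col (C.cinvAt b - 1) = b) && decide (C.cinvAt b - 1 < C.k) &&
        decide (ent a b % pr = msum acc (C.cinvAt b - 1) % pr)))

/-- The checks of the rows `lo, lo + 1, …, lo + n - 1` (for chunked kernel evaluation). [folklore] -/
def rowsCheck : ℕ → ℕ → Bool
  | _, 0 => true
  | lo, n + 1 => rowCheck pr ent cand C fuel lo && rowsCheck (lo + 1) n

variable (colOK : ℕ → Bool)

/-- **The global check**: every column of the minor is found by the inverse table and is
admissible. [folklore] -/
def globalCheck : Bool :=
  (List.range C.k).all fun j => decide (C.cinvAt (C.col j) = j + 1) && colOK (C.col j)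

variable {pr ent cand C fuel}

/-- A checked chunk certifies each of its rows. [folklore] -/
theorem rowsCheck_spec {lo n : ℕ} (h : rowsCheck pr ent cand C fuel lo n = true) {i : ℕ}
    (hlo : lo ≤ i) (hhi : i < lo + n) : rowCheck pr ent cand C fuel i = true := by
  induction n generalizing lo with
  | zero => omega
  | succ n ih =>
    rw [rowsCheck, Bool.and_eq_true] at h
    rcases Nat.eq_or_lt_of_le hlo with rfl | hlt
    · exact h.1
    · exact ih h.2 hlt (by omega)

end Checker

/-! ## Exactness of the sparse row operations for `msum` -/

section Exact

variable {pr : ℕ}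

/-- Scaling a row scales its values (modulo `pr`). [folklore] -/
theorem msum_scaleRow_cast (v : ℕ) (l : List (ℕ × ℕ)) (j : ℕ) :
    ((msum (scaleRow pr v l) j : ℕ) : ZMod pr) = (v : ZMod pr) * (msum l j : ℕ) := by
  induction l with
  | nil => simp [scaleRow]
  | cons e l ih =>
    simp only [scaleRow, List.map_cons, msum_cons, Nat.cast_add] at ih ⊢
    rw [ih, mul_add]
    congr 1
    split_ifs
    · rw [ZMod.natCast_mod, Nat.cast_mul]
    · simp

/-- Splitting preserves values. [folklore] -/
theorem msum_splitAlt (l : List (ℕ × ℕ)) (j : ℕ) :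
    msum (splitAlt l).1 j + msum (splitAlt l).2 j = msum l j := by
  induction l with
  | nil => rfl
  | cons e l ih =>
    simp only [splitAlt, msum_cons]
    omega

/-- Merging adds values (modulo `pr`), whatever the fuel. [folklore] -/
theorem msum_mergeKV_cast (f : ℕ) :
    ∀ l₁ l₂ : List (ℕ × ℕ), ∀ j : ℕ,
      ((msum (mergeKV pr f l₁ l₂) j : ℕ) : ZMod pr) = (msum l₁ j : ℕ) + (msum l₂ j : ℕ) := by
  induction f with
  | zero => intro l₁ l₂ j; simp [mergeKV, msum_append]
  | succ f ih =>
    intro l₁ l₂ j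
    cases l₁ with
    | nil => simp [mergeKV]
    | cons e₁ l₁ =>
      cases l₂ with
      | nil => simp [mergeKV]
      | cons e₂ l₂ =>
        simp only [mergeKV]
        split_ifs with h1 h2 h3
        · rw [msum_cons, msum_cons, Nat.cast_add, ih, msum_cons]
          push_cast
          ring
        · rw [msum_cons, Nat.cast_add, ih, msum_cons, msum_cons]
          push_cast
          ring
        · have he : e₁.1 = e₂.1 := by omega
          rw [ih, msum_cons, msum_cons]
          push_cast
          have h0 : ((e₁.2 : ℕ) : ZMod pr) + (e₂.2 : ℕ) = 0 := by
            rw [← Nat.cast_add, ← ZMod.natCast_mod, h3, Nat.cast_zero]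
          by_cases hj : e₁.1 = j
          · rw [if_pos hj, if_pos (he ▸ hj)]
            have e : ((e₁.2 : ℕ) : ZMod pr) + (msum l₁ j : ℕ) + ((e₂.2 : ℕ) + (msum l₂ j : ℕ)) =
                ((e₁.2 : ℕ) + (e₂.2 : ℕ)) + ((msum l₁ j : ℕ) + (msum l₂ j : ℕ)) := by ring
            rw [e, h0, zero_add]
          · rw [if_neg hj, if_neg (fun h => hj (he.trans h))]
            ring
        · have he : e₁.1 = e₂.1 := by omega
          rw [msum_cons, Nat.cast_add, ih, msum_cons, msum_cons]
          push_cast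
          by_cases hj : e₁.1 = j
          · simp only [hj, he ▸ hj, if_true]
            rw [ZMod.natCast_mod, Nat.cast_add]
            ring
          · rw [if_neg hj, if_neg (fun h => hj (he.trans h))]
            simp only [if_neg hj]
            ring

/-- Sorting preserves values (modulo `pr`), whatever the fuel. [folklore] -/
theorem msum_msort_cast (f : ℕ) :
    ∀ l : List (ℕ × ℕ), ∀ j : ℕ, ((msum (msort pr f l) j : ℕ) : ZMod pr) = (msum l j : ℕ) := by
  induction f with
  | zero => intro l j; rfl
  | succ f ih =>
    intro l j
    match l with
    | [] => rfl
    | [e] => rfl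
    | e :: e' :: l =>
      simp only [msort]
      rw [msum_mergeKV_cast, ih, ih, ← Nat.cast_add, msum_splitAlt]

/-- The value of the accumulated row `i` at `j`: `U_{ij} + ∑_{(s,v) ∈ L_i} v U_{sj}` (modulo `pr`).
[folklore] -/
theorem msum_accRow_cast (C : Cert) (i j : ℕ) :
    ((msum (accRow pr C i) j : ℕ) : ZMod pr) =
      (msum (C.uRow i) j : ℕ) +
        ((C.lRow i).map fun e => (e.2 : ZMod pr) * (msum (C.uRow e.1) j : ℕ)).sum := by
  rw [accRow, msum_append, Nat.cast_add, msum_flatMap, Nat.cast_list_sum, List.map_map]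
  congr 1
  exact congrArg List.sum (List.map_congr_left fun e _ => msum_scaleRow_cast e.2 (C.uRow e.1) j)

/-- The sparse sum over `L_i` equals the dense sum over all keys below `i`. [folklore] -/
theorem sum_ite_msum_mul {R : Type*} [CommRing R] {k : ℕ} (i : Fin k) (g : ℕ → R) :
    ∀ l : List (ℕ × ℕ), (∀ e ∈ l, e.1 < i.val) →
      (∑ s : Fin k, if s.val < i.val then ((msum l s.val : ℕ) : R) * g s.val else 0) =
        (l.map fun e => ((e.2 : ℕ) : R) * g e.1).sum
  | [], _ => by simp
  | e :: l, hlt => by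
    have he : e.1 < i.val := hlt e (by simp)
    have hek : e.1 < k := he.trans i.isLt
    have ih := sum_ite_msum_mul i g l fun e' he' => hlt e' (by simp [he'])
    simp only [List.map_cons, List.sum_cons, msum_cons, Nat.cast_add, add_mul]
    rw [← ih]
    have key : ∀ s : Fin k,
        (if s.val < i.val then
            (((if e.1 = s.val then e.2 else 0 : ℕ) : R) * g s.val + ((msum l s.val : ℕ) : R) * g s.val)
          else 0) =
          (if s = ⟨e.1, hek⟩ then ((e.2 : ℕ) : R) * g e.1 else 0) +
            (if s.val < i.val then ((msum l s.val : ℕ) : R) * g s.val else 0) := by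
      intro s
      by_cases hs : s = ⟨e.1, hek⟩
      · subst hs
        simp [he]
      · have hs' : e.1 ≠ s.val := fun h => hs (Fin.ext h.symm)
        simp [hs, hs']
    rw [Finset.sum_congr rfl fun s _ => key s, Finset.sum_add_distrib, Finset.sum_ite_eq']
    simp

end Exact

/-! ## Soundness -/

section Soundness

variable {pr : ℕ} {ent : ℕ → ℕ → ℕ} {cand : ℕ → List ℕ} {C : Cert} {fuel : ℕ} {colOK : ℕ → Bool}

/-- Unpacking of a row check. [folklore] -/
theorem rowCheck_spec {i : ℕ} (h : rowCheck pr ent cand C fuel i = true) :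
    (∀ e ∈ C.uRow i, i ≤ e.1) ∧ msum (C.uRow i) i % pr ≠ 0 ∧ (∀ e ∈ C.lRow i, e.1 < i) ∧
      (∀ e ∈ msort pr fuel (accRow pr C i),
        e.2 % pr = 0 ∨ ∃ b ∈ cand (C.row i), C.cinvAt b = e.1 + 1) ∧
      (∀ b ∈ cand (C.row i), C.cinvAt b = 0 ∨
        (C.col (C.cinvAt b - 1) = b ∧ C.cinvAt b - 1 < C.k ∧
          ent (C.row i) b % pr = msum (msort pr fuel (accRow pr C i)) (C.cinvAt b - 1) % pr)) := by
  unfold rowCheck at h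
  simp only [Bool.and_eq_true, List.all_eq_true, decide_eq_true_eq, Bool.not_eq_true',
    decide_eq_false_iff_not, Bool.or_eq_true, List.any_eq_true] at h
  obtain ⟨⟨⟨⟨h1, h2⟩, h3⟩, h4⟩, h5⟩ := h
  exact ⟨h1, h2, h3, fun e he => h4 e he,
    fun b hb => (h5 b hb).elim Or.inl fun h => Or.inr ⟨h.1.1, h.1.2, h.2⟩⟩

/-- Unpacking of the global check. [folklore] -/
theorem globalCheck_spec (h : globalCheck C colOK = true) {j : ℕ} (hj : j < C.k) :
    C.cinvAt (C.col j) = j + 1 ∧ colOK (C.col j) = true := by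
  unfold globalCheck at h
  simp only [List.all_eq_true, List.mem_range, Bool.and_eq_true, decide_eq_true_eq] at h
  exact h j hj

/-- **Soundness of the row-sparse LU certificate.**  Let `A` be an integer matrix, `decR`, `decC`
decoders of row/column codes, `ent` an entry function on codes agreeing with `A` modulo a prime
`pr`, and `cand` a candidate function such that an entry of `A` in an admissible column code `b`
(`colOK b`) of the row with code `a` is non-zero only if `b ∈ cand a`.  If the global check and the
checks of the rows `0, …, k - 1` of the certificate `C` pass, then `k ≤ rank A` over any field of
characteristic zero. [folklore] -/
theorem le_rank_of_checks {K : Type*} [Field K] [CharZero K] {m n : Type*} [Fintype m] [Fintype n]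
    [DecidableEq m] [DecidableEq n] (A : Matrix m n ℤ) [hp : Fact pr.Prime]
    (decR : ℕ → m) (decC : ℕ → n)
    (hent : ∀ a b, ((ent a b : ℕ) : ZMod pr) = ((A (decR a) (decC b) : ℤ) : ZMod pr))
    (hcand : ∀ a b, colOK b = true → A (decR a) (decC b) ≠ 0 → b ∈ cand a)
    (hglob : globalCheck C colOK = true) (hrows : ∀ i < C.k, rowCheck pr ent cand C fuel i = true) :
    C.k ≤ (A.map (Int.castRingHom K)).rank := by
  classical
  set k := C.k with hk
  let r : Fin k → m := fun i => decR (C.row i.val)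
  let c : Fin k → n := fun j => decC (C.col j.val)
  -- the factors over `ZMod pr`
  let Lm : Matrix (Fin k) (Fin k) (ZMod pr) := fun i s =>
    if s.val < i.val then ((msum (C.lRow i.val) s.val : ℕ) : ZMod pr) else if s = i then 1 else 0
  let Um : Matrix (Fin k) (Fin k) (ZMod pr) := fun s j => ((msum (C.uRow s.val) j.val : ℕ) : ZMod pr)
  have hLm : ∀ i s : Fin k, Lm i s =
      if s.val < i.val then ((msum (C.lRow i.val) s.val : ℕ) : ZMod pr) else if s = i then 1 else 0 :=
    fun _ _ => rfl
  have hUm : ∀ s j : Fin k, Um s j = ((msum (C.uRow s.val) j.val : ℕ) : ZMod pr) := fun _ _ => rfl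
  -- `U` is upper triangular with non-zero diagonal
  have hUtri : Um.BlockTriangular id := by
    intro s j hjs
    have hjs' : j.val < s.val := hjs
    rw [hUm, msum_eq_zero_of_forall_ne, Nat.cast_zero]
    intro e he hej
    have := (rowCheck_spec (hrows s.val s.isLt)).1 e he
    omega
  have hUdet : Um.det ≠ 0 := by
    rw [Matrix.det_of_upperTriangular hUtri]
    refine Finset.prod_ne_zero_iff.2 fun s _ => ?_
    rw [hUm, Ne, ZMod.natCast_eq_zero_iff]
    intro hd
    exact (rowCheck_spec (hrows s.val s.isLt)).2.1 (Nat.mod_eq_zero_of_dvd hd)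
  -- `L` is unit lower triangular
  have hLtri : Lm.BlockTriangular OrderDual.toDual := by
    intro i s his
    have his' : i.val < s.val := his
    rw [hLm, if_neg (by omega), if_neg (fun h => by rw [h] at his'; exact lt_irrefl _ his')]
  have hLdet : Lm.det = 1 := by
    rw [Matrix.det_of_lowerTriangular Lm hLtri]
    refine Finset.prod_eq_one fun i _ => ?_
    rw [hLm, if_neg (lt_irrefl _), if_pos rfl]
  -- `(L · U) i j` is the combined sparse row, modulo `pr`
  have hLUacc : ∀ i j : Fin k, (Lm * Um) i j =
      ((msum (msort pr fuel (accRow pr C i.val)) j.val : ℕ) : ZMod pr) := by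
    intro i j
    rw [msum_msort_cast, msum_accRow_cast, Matrix.mul_apply]
    have hsplit : ∀ s : Fin k, Lm i s * Um s j = (if s = i then Um i j else 0) +
        (if s.val < i.val then
          ((msum (C.lRow i.val) s.val : ℕ) : ZMod pr) * ((msum (C.uRow s.val) j.val : ℕ) : ZMod pr)
          else 0) := by
      intro s
      by_cases hs : s = i
      · subst hs
        rw [hLm, if_neg (lt_irrefl _), if_pos rfl, if_pos rfl, if_neg (lt_irrefl _), one_mul, add_zero]
      · by_cases hlt : s.val < i.val
        · rw [hLm, if_pos hlt, if_neg hs, if_pos hlt, zero_add]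
        · rw [hLm, if_neg hlt, if_neg hs, if_neg hs, if_neg hlt, zero_mul, add_zero]
    rw [Finset.sum_congr rfl fun s _ => hsplit s, Finset.sum_add_distrib, Finset.sum_ite_eq']
    simp only [Finset.mem_univ, if_true]
    rw [hUm, sum_ite_msum_mul i (fun s => ((msum (C.uRow s) j.val : ℕ) : ZMod pr)) (C.lRow i.val)
      (rowCheck_spec (hrows i.val i.isLt)).2.2.1]
  -- the combined sparse row is the row of `A`, modulo `pr`
  have hAcc : ∀ i j : Fin k, ((msum (msort pr fuel (accRow pr C i.val)) j.val : ℕ) : ZMod pr) =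
      ((A (r i) (c j) : ℤ) : ZMod pr) := by
    intro i j
    obtain ⟨-, -, -, h4, h5⟩ := rowCheck_spec (hrows i.val i.isLt)
    obtain ⟨hcinv, hok⟩ := globalCheck_spec hglob j.isLt
    set acc := msort pr fuel (accRow pr C i.val) with hacc
    by_cases hb : C.col j.val ∈ cand (C.row i.val)
    · rcases h5 _ hb with h0 | ⟨-, -, he⟩
      · rw [hcinv] at h0; exact absurd h0 (Nat.succ_ne_zero _)
      · rw [hcinv, Nat.add_sub_cancel] at he
        rw [← hent, ZMod.natCast_eq_natCast_iff']
        exact he.symm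
    · -- the column is not a candidate: both sides vanish
      have hA : A (r i) (c j) = 0 := by
        by_contra hne
        exact hb (hcand _ _ hok hne)
      rw [hA, Int.cast_zero, ZMod.natCast_eq_zero_iff]
      refine dvd_msum_of_forall fun e he hej => ?_
      rcases h4 e he with h0 | ⟨b, hbc, hbe⟩
      · exact Nat.dvd_of_mod_eq_zero h0
      · exfalso
        rcases h5 b hbc with h0 | ⟨hcol, -, -⟩
        · rw [hbe] at h0; exact absurd h0 (Nat.succ_ne_zero _)
        · rw [hbe, Nat.add_sub_cancel, hej] at hcol
          exact hb (hcol ▸ hbc)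
  have hLU : Lm * Um = (A.submatrix r c).map (Int.castRingHom (ZMod pr)) := by
    ext i j
    rw [hLUacc, hAcc, Matrix.map_apply, Matrix.submatrix_apply, eq_intCast]
  -- conclude: the minor is non-zero modulo `pr`, hence over `ℤ` and over `K`
  have hdetZ : (A.submatrix r c).det ≠ 0 := by
    intro hdet
    have h1 : ((A.submatrix r c).map (Int.castRingHom (ZMod pr))).det = 0 := by
      rw [← RingHom.mapMatrix_apply, ← RingHom.map_det, hdet, map_zero]
    rw [← hLU, Matrix.det_mul, hLdet, one_mul] at h1
    exact hUdet h1
  have hdetK : ((A.map (Int.castRingHom K)).submatrix r c).det ≠ 0 := by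
    rw [show (A.map (Int.castRingHom K)).submatrix r c = (A.submatrix r c).map (Int.castRingHom K)
      from rfl, ← RingHom.mapMatrix_apply, ← RingHom.map_det, Ne, eq_intCast, Int.cast_eq_zero]
    exact hdetZ
  have hunit : IsUnit ((A.map (Int.castRingHom K)).submatrix r c) :=
    (Matrix.isUnit_iff_isUnit_det _).2 (isUnit_iff_ne_zero.2 hdetK)
  have hrank := Matrix.rank_of_isUnit _ hunit
  rw [Fintype.card_fin] at hrank
  calc k = ((A.map (Int.castRingHom K)).submatrix r c).rank := hrank.symm
    _ ≤ (A.map (Int.castRingHom K)).rank := Matrix.rank_submatrix_le _ _ _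

end Soundness

end RowLU

end Literature.Computability.AlgebraicComplexity
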